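import Summits.CriticalPhenomena.Ising3DConformalLimit.Theorems.PlantedPinningGaussianPinningSaturationDefs
import Literature.Probability.LatticeModels.CriticalTwoPointBounds

/-!
# The `+` box susceptibility at `β_c(3)` diverges (stub B1 `stub_boxSusceptibilityFloor`)

Stub B1 of the line `birth` (linear-benchmark split `e = e^{lin} − e^{gap}`) for the crux
`GaussianPinningSaturation` (item stmt-CriticalPhenomena-8452), in the reshaped form
`B ⇐ B1 ∧ B2` of stub B (`TwoPointSaturation`); it kills the `1/(A·v_0)` term of the Riccati
bookkeeping of the linear flow (glue `twoPointSaturation_of_floor_of_riccati`).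

**Statement** (`stub_boxSusceptibilityFloor`, the route-posited `BoxSusceptibilityFloor`): for
every real `C` there is `L₀` with
`C · |Λ_L| ≤ Σ_{x,y ∈ Λ_L} Cov⁺_{Λ_L;β_c(3),0}(σ_x, σ_y) = Var⁺_{Λ_L}(M_L)`
for all `L ≥ L₀`, where `Λ_L = box 3 L = [-L,L]³` and
`cov L x y = ⟨σ_xσ_y⟩⁺_{Λ_L} − ⟨σ_x⟩⁺_{Λ_L}⟨σ_y⟩⁺_{Λ_L}`
at `β = β_c(3)`, `h = 0`, `+` boundary condition (`plusE`, `cov` of the `…Defs` file).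

**Proof** (every input is a theorem of `Literature.Probability.LatticeModels`):
* (i) positivity `cov L x y ≥ 0` — FKG (`ising_fkg_holds` with `spinAt_mono`), so the double sum
  dominates its restriction to any sub-family of pairs;
* (ii) two-point floor: for `x ≠ y` in `Λ_L`,
  `⟨σ_xσ_y⟩⁺_{Λ_L} ≥ ⟨σ_xσ_y⟩⁺_{β_c} = ⟨σ₀σ_{y−x}⟩⁺_{β_c} ≥ c‖y − x‖_∞^{−2}`
  — volume antitonicity of `+` correlations (GKS; `plusCorr_le_isingCorr_plus_box`),
  translation invariance
  (`plusPair_eq_twoPointPlus_sub`) and the lower bound of Duminil-Copin 2019, Thm. 4.8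
  (`criticalTwoPoint_bounds_holds`; Simon 1980, Lieb 1980);
* (iii) magnetisation ceiling: if `x + Λ_ℓ ⊆ Λ_L` then
  `0 ≤ ⟨σ_x⟩⁺_{Λ_L} ≤ ⟨σ_x⟩⁺_{x+Λ_ℓ} = ⟨σ₀⟩⁺_{Λ_ℓ} =: m_ℓ → m*(β_c(3)) = 0`
  — GKS I, FKG volume antitonicity (`isingExpect_plus_anti_volume_of_fkg`), translation covariance
  (`isingExpect_plus_shift`) and `m*(β_c) = 0` for `d = 3` (Aizenman–Duminil-Copin–Sidoravicius
  2015, Thm. 1.2; `spontaneousMagnetization_criticalBeta_eq_zero_holds`);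
* (iv) counting (cube version): `cov L x (z+x) ≥ c R^{−2} − m_ℓ²` for `x ∈ Λ_M`,
  `M + ℓ + R ≤ L`, `z ∈ Λ_R ∖ {0}`; summing over the `(2R+1)³ − 1 ≥ 8R³` sites `z` and over
  `x ∈ Λ_M` gives
  `≥ |Λ_M| · 4cR ≥ |Λ_M| · (2C + 2)` once `m_ℓ² ≤ c/(2R²)` and `2cR ≥ C + 1`, and
  `2|Λ_M| ≥ |Λ_L|` for `M = L − ℓ − R ≥ 4(ℓ + R)`.

References: H. Duminil-Copin, *Lectures on the Ising and Potts models on the hypercubic lattice*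
(2019), Thm. 4.8; M. Aizenman, H. Duminil-Copin, V. Sidoravicius, Comm. Math. Phys. 334 (2015),
Thm. 1.2; S. Friedli, Y. Velenik, *Statistical Mechanics of Lattice Systems* (2017), Thm. 3.17,
Thm. 3.21, Exercise 3.12.
-/

noncomputable section

namespace Summit.CriticalPhenomena.Ising3DConformalLimit.PlantedPinningGaussianPinningSaturation

open scoped BigOperators Classical Topology
open Finset MeasureTheory Filter
open Literature.Probability.LatticeModels
open Summit.CriticalPhenomena.Ising3DConformalLimit.Theses.PlantedPinning

/-! ### (i) FKG positivity of the truncated two-point function -/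

/-- `Cov⁺_{Λ_L}(σ_x, σ_y) ≥ 0`: FKG for the increasing observables `σ_x`, `σ_y`
(Friedli–Velenik 2017, Thm. 3.21). -/
private theorem cov_nonneg (L : ℕ) (x y : Site 3) : 0 ≤ cov L x y := by
  have h := ising_fkg_holds (zdGraph 3) (criticalBeta_nonneg 3) (box 3 L) 0 .plus (spinAt x)
    (spinAt y) (spinAt_mono x) (spinAt_mono y) (measurable_spinAt x) (measurable_spinAt y)
  unfold cov plusE
  exact sub_nonneg.2 h

/-! ### (ii) The two-point floor inside the box -/

/-- For `x ≠ y` in `Λ_L`: `c / ‖y − x‖_∞² ≤ ⟨σ_xσ_y⟩⁺_{Λ_L;β_c,0}`, with the constant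
`c > 0` of the critical lower bound `⟨σ₀σ_v⟩⁺_{β_c} ≥ c‖v‖^{-(d-1)}`
(Duminil-Copin 2019, Thm. 4.8), via
`⟨σ_xσ_y⟩⁺_{Λ_L} ≥ ⟨σ_xσ_y⟩⁺_{β_c} = ⟨σ₀σ_{y−x}⟩⁺_{β_c}`
(GKS volume antitonicity, translation invariance). -/
private theorem pair_floor :
    ∃ c : ℝ, 0 < c ∧ ∀ (L : ℕ) (x y : Site 3), x ∈ box 3 L → y ∈ box 3 L → x ≠ y →
        c / ‖y - x‖ ^ 2 ≤ plusE L (fun σ => spinAt x σ * spinAt y σ) := by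
  obtain ⟨c, C, hc, hb⟩ := criticalTwoPoint_bounds_holds (d := 3) le_rfl
  refine ⟨c, hc, fun L x y hx hy hxy => ?_⟩
  have hyx : y - x ≠ 0 := sub_ne_zero.2 (Ne.symm hxy)
  have h1 := (hb (y - x) hyx).1
  rw [show (-(((3 : ℕ) : ℝ) - 1)) = -(2 : ℝ) by norm_num, Real.rpow_neg (norm_nonneg _),
    Real.rpow_two, ← div_eq_mul_inv] at h1
  have h2 : criticalTwoPoint 3 (y - x) = plusCorr 3 (criticalBeta 3) 0 {x, y} := by
    rw [criticalTwoPoint, ← plusPair_eq_twoPointPlus_sub (criticalBeta_nonneg 3) x y, plusPair,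
      plusCorr, spinPair_eq_spinProduct hxy]
  have h3 : plusCorr 3 (criticalBeta 3) 0 {x, y} ≤
      isingCorr (zdGraph 3) (box 3 L) (criticalBeta 3) 0 .plus {x, y} :=
    plusCorr_le_isingCorr_plus_box (criticalBeta_nonneg 3) le_rfl
      (Finset.insert_subset hx (Finset.singleton_subset_iff.2 hy))
  have h4 : isingCorr (zdGraph 3) (box 3 L) (criticalBeta 3) 0 .plus {x, y} =
      plusE L (fun σ => spinAt x σ * spinAt y σ) := by
    rw [isingCorr, ← spinPair_eq_spinProduct hxy]
    rfl
  calc c / ‖y - x‖ ^ 2 ≤ criticalTwoPoint 3 (y - x) := h1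
    _ = _ := h2
    _ ≤ _ := h3
    _ = _ := h4

/-! ### (iii) The magnetisation ceiling near depth `ℓ` -/

/-- `m_ℓ := ⟨σ₀⟩⁺_{Λ_ℓ;β_c(3),0} → m*(β_c(3)) = 0` (existence of the plus state,
Friedli–Velenik 2017, Thm. 3.17; `m*(β_c) = 0` in `d = 3`,
Aizenman–Duminil-Copin–Sidoravicius 2015, Thm. 1.2). -/
private theorem mag_tendsto_zero :
    Tendsto (fun ℓ : ℕ => plusE ℓ (spinAt 0)) atTop (𝓝 0) := by
  have h := tendsto_isingExpect_plus_spinAt (d := 3) hasBoxLimit_isingCorr_plus_holds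
    (criticalBeta_nonneg 3) 0
  have h0 : plusExpect 3 (criticalBeta 3) 0 (spinAt 0) = 0 :=
    spontaneousMagnetization_criticalBeta_eq_zero_holds (d := 3) le_rfl
  rw [h0] at h
  exact h

/-- `⟨σ_x⟩⁺_{Λ_L} ≤ ⟨σ_x⟩⁺_{x + Λ_ℓ} = ⟨σ₀⟩⁺_{Λ_ℓ}` when `x + Λ_ℓ ⊆ Λ_L`
(FKG volume antitonicity, Friedli–Velenik 2017, Lemma 3.22; translation covariance of the
finite-volume plus state). -/
private theorem mag_le {L ℓ : ℕ} {x : Site 3} (hx : Site.supNorm x + ℓ ≤ L) :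
    plusE L (spinAt x) ≤ plusE ℓ (spinAt 0) := by
  have hsub : (box 3 ℓ).map (Site.shift x).toEmbedding ⊆ box 3 L :=
    (map_shift_box_subset ℓ x).trans (box_mono 3 (by omega))
  have h1 : plusE L (spinAt x) ≤
      isingExpect (zdGraph 3) ((box 3 ℓ).map (Site.shift x).toEmbedding) (criticalBeta 3) 0 .plus
        (spinAt x) :=
    isingExpect_plus_anti_volume_of_fkg (zdGraph 3) (ising_fkg_holds (zdGraph 3))
      (criticalBeta_nonneg 3) 0 hsub (spinAt_mono x) (measurable_spinAt x)
  have h2 : spinAt x ∘ configShift x = (spinAt 0 : SpinConfig (Site 3) → ℝ) := by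
    funext s
    simp [spinAt, configShift_apply]
  rw [isingExpect_plus_shift (box 3 ℓ) x (criticalBeta 3) 0 (measurable_spinAt x), h2] at h1
  exact h1

/-- GKS I: `0 ≤ ⟨σ_x⟩⁺_{Λ_L;β_c,0}` for `x ∈ Λ_L`
(Friedli–Velenik 2017, Thm. 3.20, eq. (3.21)). -/
private theorem mag_nonneg (L : ℕ) {x : Site 3} (hx : x ∈ box 3 L) :
    0 ≤ plusE L (spinAt x) := by
  have hs : spinProduct ({x} : Finset (Site 3)) = spinAt x := by
    funext s
    simp [spinProduct]
  have h1 := GKSInequalities.gks_one_holds (zdGraph 3) (Λ := box 3 L) (A := {x})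
    (β := criticalBeta 3) (h := 0) (bc := .plus) (criticalBeta_nonneg 3) le_rfl (Or.inr rfl)
    (Finset.singleton_subset_iff.2 hx)
  rw [isingCorr, hs] at h1
  exact h1

/-! ### (iv) Counting -/

/-- Per-term floor: for `x ∈ Λ_M` with `M + ℓ + R ≤ L` and `z ∈ Λ_R ∖ {0}`,
`cov L x (z + x) ≥ c/R² − m_ℓ²` (two-point floor with `‖z‖_∞ ≤ R`, magnetisation ceiling at
depth `ℓ` for both `x` and `z + x`, GKS I). -/
private theorem term_floor {c : ℝ} (hc : 0 ≤ c)
    (hpair : ∀ (L : ℕ) (x y : Site 3), x ∈ box 3 L → y ∈ box 3 L → x ≠ y →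
      c / ‖y - x‖ ^ 2 ≤ plusE L (fun σ => spinAt x σ * spinAt y σ))
    {L ℓ R M : ℕ} (hM : M + ℓ + R ≤ L) {x z : Site 3} (hx : x ∈ box 3 M)
    (hz : z ∈ (box 3 R).erase 0) :
    c / (R : ℝ) ^ 2 - plusE ℓ (spinAt 0) ^ 2 ≤ cov L x (z + x) := by
  rw [mem_box_iff_supNorm_le] at hx
  obtain ⟨hz0, hzR⟩ := Finset.mem_erase.1 hz
  rw [mem_box_iff_supNorm_le] at hzR
  have hz1 : Site.supNorm z ≠ 0 := fun h => hz0 (Site.supNorm_eq_zero_iff.1 h)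
  have hzx : Site.supNorm (z + x) ≤ Site.supNorm z + Site.supNorm x := Site.supNorm_add_le z x
  have hxL : x ∈ box 3 L := mem_box_iff_supNorm_le.2 (by omega)
  have hzxL : z + x ∈ box 3 L := mem_box_iff_supNorm_le.2 (by omega)
  have hne : x ≠ z + x := fun h => hz0 (by simpa using h.symm)
  -- the two-point part
  have h1 := hpair L x (z + x) hxL hzxL hne
  rw [add_sub_cancel_right, Site.norm_eq_supNorm] at h1
  have hn0 : (0 : ℝ) < (Site.supNorm z : ℝ) := by positivity
  have h2 : c / (R : ℝ) ^ 2 ≤ c / (Site.supNorm z : ℝ) ^ 2 :=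
    div_le_div_of_nonneg_left hc (pow_pos hn0 2)
      (pow_le_pow_left₀ hn0.le (by exact_mod_cast hzR) 2)
  -- the magnetisation part
  have hmx : plusE L (spinAt x) ≤ plusE ℓ (spinAt 0) := mag_le (by omega)
  have hmzx : plusE L (spinAt (z + x)) ≤ plusE ℓ (spinAt 0) := mag_le (by omega)
  have h0x : 0 ≤ plusE L (spinAt x) := mag_nonneg L hxL
  have h0zx : 0 ≤ plusE L (spinAt (z + x)) := mag_nonneg L hzxL
  have h3 : plusE L (spinAt x) * plusE L (spinAt (z + x)) ≤ plusE ℓ (spinAt 0) ^ 2 := by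
    rw [sq]
    exact mul_le_mul hmx hmzx h0zx (h0x.trans hmx)
  unfold cov
  linarith

/-- Cube-ratio inequality: `(2(a+s)+1)³ ≤ 2(2a+1)³` for `0 ≤ s`, `4s ≤ a`
(`2(a+s)+1 ≤ (5/4)(2a+1)` and `(5/4)³ ≤ 2`). -/
private theorem cube_ratio (a s : ℝ) (hs : 0 ≤ s) (h : 4 * s ≤ a) :
    (2 * (a + s) + 1) ^ 3 ≤ 2 * (2 * a + 1) ^ 3 := by
  have ha : 0 ≤ 2 * a + 1 := by linarith
  have hb : 2 * (a + s) + 1 ≤ 5 / 4 * (2 * a + 1) := by linarith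
  calc (2 * (a + s) + 1) ^ 3
      ≤ (5 / 4 * (2 * a + 1)) ^ 3 := pow_le_pow_left₀ (by linarith) hb 3
    _ ≤ 2 * (2 * a + 1) ^ 3 := by nlinarith [pow_nonneg ha 3]

/-- **Stub `stub_boxSusceptibilityFloor`** (B1, registered signature verbatim): the susceptibility
of the critical `+` box diverges — for every `C`, eventually
`C·|Λ_L| ≤ Σ_{x,y∈Λ_L} Cov⁺_{Λ_L}(σ_x,σ_y)` (Duminil-Copin 2019, Thm. 4.8, with
Aizenman–Duminil-Copin–Sidoravicius 2015, Thm. 1.2, GKS and FKG). -/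
theorem stub_boxSusceptibilityFloor :
    ∀ C : ℝ, ∃ L₀ : ℕ, ∀ L ≥ L₀,
      C * ((box 3 L).card : ℝ) ≤ ∑ x ∈ box 3 L, ∑ y ∈ box 3 L, cov L x y := by
  intro C
  have hsum_nonneg : ∀ L : ℕ, 0 ≤ ∑ x ∈ box 3 L, ∑ y ∈ box 3 L, cov L x y := fun L =>
    Finset.sum_nonneg fun x _ => Finset.sum_nonneg fun y _ => cov_nonneg L x y
  by_cases hC : C ≤ 0
  · exact ⟨0, fun L _ =>
      (mul_nonpos_of_nonpos_of_nonneg hC (Nat.cast_nonneg _)).trans (hsum_nonneg L)⟩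
  push Not at hC
  obtain ⟨c, hc, hpair⟩ := pair_floor
  -- the radius `R` of the cube of partners: `2 c R ≥ C + 1`
  obtain ⟨R, hR1, hRC⟩ : ∃ R : ℕ, 1 ≤ R ∧ C + 1 ≤ 2 * c * R := by
    refine ⟨⌈(C + 1) / (2 * c)⌉₊ + 1, Nat.le_add_left 1 _, ?_⟩
    have h1 : (C + 1) / (2 * c) ≤ (⌈(C + 1) / (2 * c)⌉₊ : ℝ) := Nat.le_ceil _
    rw [div_le_iff₀ (by positivity)] at h1
    push_cast
    nlinarith
  have hR0 : 0 < R := hR1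
  have hRr : (0 : ℝ) < R := by exact_mod_cast hR0
  -- the depth `ℓ`: `m_ℓ² < c / (2R²)`
  obtain ⟨ℓ, hℓ⟩ : ∃ ℓ : ℕ, plusE ℓ (spinAt 0) ^ 2 < c / (2 * (R : ℝ) ^ 2) := by
    have ht : Tendsto (fun ℓ : ℕ => plusE ℓ (spinAt 0) ^ 2) atTop (𝓝 0) := by
      simpa using mag_tendsto_zero.pow 2
    exact (ht.eventually (gt_mem_nhds (by positivity))).exists
  refine ⟨5 * (ℓ + R), fun L hL => ?_⟩
  obtain ⟨M, hM⟩ : ∃ M : ℕ, L = M + (ℓ + R) := ⟨L - (ℓ + R), by omega⟩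
  have hML : M + ℓ + R ≤ L := by omega
  have hM4 : 4 * (ℓ + R) ≤ M := by omega
  -- Step 1: restrict the double sum to `x ∈ Λ_M`, `y = z + x`, `z ∈ Λ_R ∖ {0}`
  have step1 : ∑ x ∈ box 3 M, ∑ z ∈ (box 3 R).erase 0, cov L x (z + x) ≤
      ∑ x ∈ box 3 L, ∑ y ∈ box 3 L, cov L x y := by
    calc ∑ x ∈ box 3 M, ∑ z ∈ (box 3 R).erase 0, cov L x (z + x)
        = ∑ x ∈ box 3 M, ∑ y ∈ ((box 3 R).erase 0).map (Site.shift x).toEmbedding,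
            cov L x y := by
          refine Finset.sum_congr rfl fun x _ => ?_
          rw [Finset.sum_map]
          simp only [Equiv.coe_toEmbedding, Site.shift_apply]
      _ ≤ ∑ x ∈ box 3 M, ∑ y ∈ box 3 L, cov L x y := by
          refine Finset.sum_le_sum fun x hx => ?_
          refine Finset.sum_le_sum_of_subset_of_nonneg (fun y hy => ?_) fun y _ _ =>
            cov_nonneg L x y
          rw [mem_map_shift_iff'] at hy
          have hyx := mem_box_iff_supNorm_le.1 (Finset.mem_of_mem_erase hy)
          have hx' := mem_box_iff_supNorm_le.1 hx
          have htri := Site.supNorm_add_le (y - x) x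
          rw [sub_add_cancel] at htri
          exact mem_box_iff_supNorm_le.2 (by omega)
      _ ≤ ∑ x ∈ box 3 L, ∑ y ∈ box 3 L, cov L x y :=
          Finset.sum_le_sum_of_subset_of_nonneg (box_mono 3 (by omega)) fun x _ _ =>
            Finset.sum_nonneg fun y _ => cov_nonneg L x y
  -- Step 2: the restricted sum is at least `|Λ_M| · |Λ_R ∖ {0}| · (c/R² − m_ℓ²)`
  have step2 : ((box 3 M).card : ℝ) *
      ((((box 3 R).erase 0).card : ℝ) * (c / (R : ℝ) ^ 2 - plusE ℓ (spinAt 0) ^ 2)) ≤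
      ∑ x ∈ box 3 M, ∑ z ∈ (box 3 R).erase 0, cov L x (z + x) := by
    have inner : ∀ x ∈ box 3 M,
        (((box 3 R).erase 0).card : ℝ) * (c / (R : ℝ) ^ 2 - plusE ℓ (spinAt 0) ^ 2) ≤
          ∑ z ∈ (box 3 R).erase 0, cov L x (z + x) := by
      intro x hx
      have h := Finset.card_nsmul_le_sum ((box 3 R).erase 0) (fun z => cov L x (z + x)) _
        fun z hz => term_floor hc.le hpair hML hx hz
      rwa [nsmul_eq_mul] at h
    have h := Finset.card_nsmul_le_sum (box 3 M)
      (fun x => ∑ z ∈ (box 3 R).erase 0, cov L x (z + x)) _ inner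
    rwa [nsmul_eq_mul] at h
  -- Step 3: arithmetic
  have hT : ((((box 3 R).erase 0).card : ℕ) : ℝ) = (2 * (R : ℝ) + 1) ^ 3 - 1 := by
    have h := Finset.card_erase_add_one (zero_mem_box 3 R)
    rw [card_box] at h
    rw [eq_sub_iff_add_eq]
    exact_mod_cast h
  have hT8 : 8 * (R : ℝ) ^ 3 ≤ (((box 3 R).erase 0).card : ℝ) := by
    rw [hT]
    nlinarith
  have hbox : ((box 3 L).card : ℝ) ≤ 2 * ((box 3 M).card : ℝ) := by
    have h := cube_ratio (M : ℝ) ((ℓ : ℝ) + R) (by positivity) (by exact_mod_cast hM4)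
    rw [card_box, card_box, hM]
    push_cast
    linarith
  have hRne : (R : ℝ) ≠ 0 := hRr.ne'
  have hA : 2 * C + 2 ≤
      (((box 3 R).erase 0).card : ℝ) * (c / (R : ℝ) ^ 2 - plusE ℓ (spinAt 0) ^ 2) := by
    have h1 : c / (2 * (R : ℝ) ^ 2) ≤ c / (R : ℝ) ^ 2 - plusE ℓ (spinAt 0) ^ 2 := by
      have : c / (R : ℝ) ^ 2 = 2 * (c / (2 * (R : ℝ) ^ 2)) := by
        field_simp
      linarith
    have h2 : 8 * (R : ℝ) ^ 3 * (c / (2 * (R : ℝ) ^ 2)) = 4 * c * R := by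
      field_simp
      norm_num
    calc 2 * C + 2 ≤ 4 * c * R := by linarith
      _ = 8 * (R : ℝ) ^ 3 * (c / (2 * (R : ℝ) ^ 2)) := h2.symm
      _ ≤ _ := mul_le_mul hT8 h1 (by positivity) (by positivity)
  calc C * ((box 3 L).card : ℝ) ≤ C * (2 * ((box 3 M).card : ℝ)) :=
        mul_le_mul_of_nonneg_left hbox hC.le
    _ = ((box 3 M).card : ℝ) * (2 * C) := by ring
    _ ≤ ((box 3 M).card : ℝ) *
          ((((box 3 R).erase 0).card : ℝ) * (c / (R : ℝ) ^ 2 - plusE ℓ (spinAt 0) ^ 2)) :=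
        mul_le_mul_of_nonneg_left (by linarith) (Nat.cast_nonneg _)
    _ ≤ _ := step2
    _ ≤ _ := step1

end Summit.CriticalPhenomena.Ising3DConformalLimit.PlantedPinningGaussianPinningSaturation

end
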